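import Summits.CriticalPhenomena.PercolationContinuityZ3.Theorems.PercNearOneGluingNoHeavyLowerTailRelayNeighbourhoodBase
import HarnessLib

/-!
# `NoHeavyLowerTail` (stmt-CriticalPhenomena-4575), cumulative-isolation line — LEVEL 2 FOR OBSERVERS
# WITH RELAY-ONLY NEIGHBOURHOODS (all `|A|`), via the merge lemma

Bond percolation with arbitrary edge probabilities on `Fin n` (`μ = prodBernoulli w`), relays `A`, an
observer `o ∉ A`, `N = |{x ∈ A : o ↔ x}|`, `T_v = {u ∈ A : v ↔ u}`.  The registered engine
`stub_cumulativeIsolation` asks for `P(1 ≤ N ≤ j) ≤ max_a P(|T_a| ≤ j)`; levels `j = 1` and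
`j ≥ |A| − 2` are in the tree, the first open level is `j = 2` (at `|A| = 5`).  This file proves level
`2` for every `|A|` when **every positive-weight neighbour of `o` is a relay** (Kozma–Nitzan's regime
"`0` isolated in `G ∖ A`", arXiv:2401.12397 §3.2), with the explicit witness `a` = a level-2 champion of
the graph `G − o` (all non-loop pairs at `o` closed) and in the sharper cluster-size-transfer form:

* `clusterSizeTransferTwo_of_relayNeighbourhood` — if `o ∉ A`, `a ∈ A`, every `v ≠ o` with
  `w s(o,v) > 0` lies in `A`, and `P⁰(|T_x| ≤ 2) ≤ P⁰(|T_a| ≤ 2)` for all `x ∈ A` (`P⁰` = the law with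
  the pairs at `o` given weight `0`, `pinW w {pairs at o} ∅`), then  `P(1 ≤ N ≤ 2) ≤ P(1 ≤ N ∧ |T_a| ≤ 2)`.
* `cumulativeIsolationTwo_of_relayNeighbourhood` — hence `∃ a ∈ A, P(1 ≤ N ≤ 2) ≤ P(|T_a| ≤ 2)`
  (the shape of `stub_cumulativeIsolation` at `j = 2`) for such observers.

Proof: induction on the number of pairs at `o` with weight strictly between `0` and `1`, by the
one-bond decomposition `μ_w = (1 − w e) μ_{w[e↦0]} + (w e) μ_{w[e↦1]}` (`stub_oneBondDecomp_k15`); both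
updates keep the hypotheses and the graph `G − o`.  In the base case every pair at `o` has weight `0`
or `1`, i.e. `o` is glued to a set `Q ⊆ A` of relays and otherwise isolated: `Q = ∅` gives `P(L) = 0`;
`a ∈ Q` gives `L ⊆ R` a.s.; `|Q| ≥ 3` gives `N ≥ 3` a.s.; `Q = {x}` is the champion inequality for `x`
(a pendant observer does not change the relay classes); `Q = {x, y}` is EXACTLY the merge lemma
`mergeLemma_two` (`o`'s class is `T_x ∪ T_y`, and `a`'s class is unchanged when `a ↮ x, y`), transported
along `μ_{w⁰[ox↦1][oy↦1]}(S) = μ_{w⁰}((insert oy ∘ insert ox)⁻¹ S)` (`tieLiftOne_real_one_eq`).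
-/

namespace Summit.CriticalPhenomena.PercolationContinuityZ3.Theorems

open MeasureTheory Set Literature.Probability.LatticeModels Literature.Probability.Percolation
open scoped Classical BigOperators

variable {n : ℕ}

open RelayNbhd in
/-- **Cluster-size transfer at level 2 for observers with relay-only neighbourhoods.**  For bond
percolation with arbitrary edge probabilities on `Fin n`, a relay set `A`, an observer `o ∉ A` all of
whose positive-weight pairs `s(o,v)` (`v ≠ o`) go to relays `v ∈ A`, and a relay `a ∈ A` that is a level-2
champion of the graph with the pairs at `o` closed (`P⁰(|T_x| ≤ 2) ≤ P⁰(|T_a| ≤ 2)` for every `x ∈ A`,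
`P⁰ = prodBernoulli (pinW w {e : Sym2 (Fin n) | o ∈ e ∧ ¬ e.IsDiag} ∅)`):  `P(1 ≤ N ≤ 2) ≤ P(1 ≤ N ∧ |T_a| ≤ 2)`.  Induction on the
number of fractional pairs at `o` (one-bond decomposition); base case `RelayNbhd.base_case` (champion
property for one glued relay, the merge lemma `mergeLemma_two` for two, triviality otherwise).
[cite: KozmaNitzan2024, §3.2 (p. 12) — analogue; VandenbergHaggstromKahn2005, Thm. 1.5 (p. 7)] -/
theorem clusterSizeTransferTwo_of_relayNeighbourhood (n : ℕ) (w : Sym2 (Fin n) → unitInterval)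
    (A : Finset (Fin n)) (o a : Fin n) (ho : o ∉ A) (ha : a ∈ A)
    (hrel : ∀ v : Fin n, v ≠ o → 0 < (w s(o, v) : ℝ) → v ∈ A)
    (hchamp : ∀ x ∈ A,
      (prodBernoulli (pinW w {e : Sym2 (Fin n) | o ∈ e ∧ ¬ e.IsDiag} ∅)).real
          {ω : BondConfig (Fin n) | (A.filter fun u => ω ∈ openConn x u).card ≤ 2} ≤
        (prodBernoulli (pinW w {e : Sym2 (Fin n) | o ∈ e ∧ ¬ e.IsDiag} ∅)).real
          {ω : BondConfig (Fin n) | (A.filter fun u => ω ∈ openConn a u).card ≤ 2}) :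
    (prodBernoulli w).real {ω : BondConfig (Fin n) |
        1 ≤ (A.filter fun x => ω ∈ openConn o x).card ∧
          (A.filter fun x => ω ∈ openConn o x).card ≤ 2} ≤
      (prodBernoulli w).real {ω : BondConfig (Fin n) |
        1 ≤ (A.filter fun x => ω ∈ openConn o x).card ∧
          (A.filter fun u => ω ∈ openConn a u).card ≤ 2} := by
  set L : Set (BondConfig (Fin n)) := {ω | 1 ≤ (A.filter fun x => ω ∈ openConn o x).card ∧
      (A.filter fun x => ω ∈ openConn o x).card ≤ 2} with hL
  set R : Set (BondConfig (Fin n)) := {ω | 1 ≤ (A.filter fun x => ω ∈ openConn o x).card ∧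
      (A.filter fun u => ω ∈ openConn a u).card ≤ 2} with hR
  suffices H : ∀ (m : ℕ) (w' : Sym2 (Fin n) → unitInterval),
      pinW w' {e : Sym2 (Fin n) | o ∈ e ∧ ¬ e.IsDiag} ∅ = pinW w {e : Sym2 (Fin n) | o ∈ e ∧ ¬ e.IsDiag} ∅ →
      (∀ v : Fin n, v ≠ o → 0 < (w' s(o, v) : ℝ) → v ∈ A) →
      (Finset.univ.filter fun v : Fin n =>
          v ≠ o ∧ 0 < (w' s(o, v) : ℝ) ∧ (w' s(o, v) : ℝ) < 1).card = m →
      (prodBernoulli w').real L ≤ (prodBernoulli w').real R from H _ w rfl hrel rfl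
  intro m
  induction m with
  | zero =>
    intro w' hw' hrel' hm
    have h01 : ∀ v : Fin n, v ≠ o → (w' s(o, v) : ℝ) = 0 ∨ (w' s(o, v) : ℝ) = 1 := by
      intro v hv
      by_contra hcon
      rw [not_or] at hcon
      have h0 : 0 < (w' s(o, v) : ℝ) := lt_of_le_of_ne (w' s(o, v)).2.1 (Ne.symm hcon.1)
      have h1 : (w' s(o, v) : ℝ) < 1 := lt_of_le_of_ne (w' s(o, v)).2.2 hcon.2
      have hmem : v ∈ (Finset.univ.filter fun v : Fin n =>
          v ≠ o ∧ 0 < (w' s(o, v) : ℝ) ∧ (w' s(o, v) : ℝ) < 1) :=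
        Finset.mem_filter.2 ⟨Finset.mem_univ _, hv, h0, h1⟩
      rw [Finset.card_eq_zero] at hm
      rw [hm] at hmem
      exact Finset.notMem_empty v hmem
    have hchamp' : ∀ x ∈ A,
        (prodBernoulli (pinW w' {e : Sym2 (Fin n) | o ∈ e ∧ ¬ e.IsDiag} ∅)).real
            {ω : BondConfig (Fin n) | (A.filter fun u => ω ∈ openConn x u).card ≤ 2} ≤
          (prodBernoulli (pinW w' {e : Sym2 (Fin n) | o ∈ e ∧ ¬ e.IsDiag} ∅)).real
            {ω : BondConfig (Fin n) | (A.filter fun u => ω ∈ openConn a u).card ≤ 2} := by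
      rw [hw']; exact hchamp
    exact base_case w' A o a ho ha hrel' h01 hchamp'
  | succ m ih =>
    intro w' hw' hrel' hm
    obtain ⟨v, hv⟩ := Finset.card_pos.1
      (by omega : 0 < (Finset.univ.filter fun v : Fin n =>
        v ≠ o ∧ 0 < (w' s(o, v) : ℝ) ∧ (w' s(o, v) : ℝ) < 1).card)
    obtain ⟨-, hvo, hvpos, hvlt⟩ := Finset.mem_filter.1 hv
    set e : Sym2 (Fin n) := s(o, v) with he
    -- the count drops by one for both updates
    have hcount : ∀ (c : unitInterval), ((c : ℝ) = 0 ∨ (c : ℝ) = 1) →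
        (Finset.univ.filter fun u : Fin n => u ≠ o ∧ 0 < (Function.update w' e c s(o, u) : ℝ) ∧
          (Function.update w' e c s(o, u) : ℝ) < 1).card = m := by
      intro c hc
      have hset : (Finset.univ.filter fun u : Fin n => u ≠ o ∧
            0 < (Function.update w' e c s(o, u) : ℝ) ∧ (Function.update w' e c s(o, u) : ℝ) < 1) =
          (Finset.univ.filter fun u : Fin n =>
            u ≠ o ∧ 0 < (w' s(o, u) : ℝ) ∧ (w' s(o, u) : ℝ) < 1).erase v := by
        ext u
        simp only [Finset.mem_filter, Finset.mem_univ, true_and, Finset.mem_erase]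
        by_cases huv : u = v
        · subst huv
          rw [← he, Function.update_self]
          constructor
          · rintro ⟨-, h0, h1⟩
            rcases hc with hc | hc <;> rw [hc] at h0 h1 <;> linarith
          · rintro ⟨hne, -⟩; exact absurd rfl hne
        · have hne : s(o, u) ≠ e := by
            rw [he]; intro h; exact huv (Sym2.congr_right.1 h)
          rw [Function.update_of_ne hne]
          tauto
      rw [hset, Finset.card_erase_of_mem hv, hm]
      rfl
    have hrel_upd : ∀ (c : unitInterval), ∀ u : Fin n, u ≠ o →
        0 < (Function.update w' e c s(o, u) : ℝ) → u ∈ A := by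
      intro c u hu hpos
      by_cases huv : u = v
      · subst huv; exact hrel' u hu hvpos
      · have hne : s(o, u) ≠ e := by
          rw [he]; intro h; exact huv (Sym2.congr_right.1 h)
        rw [Function.update_of_ne hne] at hpos
        exact hrel' u hu hpos
    have hz0 : pinW (Function.update w' e 0) {e : Sym2 (Fin n) | o ∈ e ∧ ¬ e.IsDiag} ∅ = pinW w {e : Sym2 (Fin n) | o ∈ e ∧ ¬ e.IsDiag} ∅ := by rw [he, pinW_star_update w' hvo, hw']
    have hz1 : pinW (Function.update w' e 1) {e : Sym2 (Fin n) | o ∈ e ∧ ¬ e.IsDiag} ∅ = pinW w {e : Sym2 (Fin n) | o ∈ e ∧ ¬ e.IsDiag} ∅ := by rw [he, pinW_star_update w' hvo, hw']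
    have h0 := ih (Function.update w' e 0) hz0 (hrel_upd 0) (hcount 0 (Or.inl rfl))
    have h1 := ih (Function.update w' e 1) hz1 (hrel_upd 1) (hcount 1 (Or.inr rfl))
    rw [stub_oneBondDecomp_k15 n w' e L, stub_oneBondDecomp_k15 n w' e R]
    have hp0 : 0 ≤ (w' e : ℝ) := (w' e).2.1
    have hp1 : (w' e : ℝ) ≤ 1 := (w' e).2.2
    exact add_le_add (mul_le_mul_of_nonneg_left h0 (by linarith)) (mul_le_mul_of_nonneg_left h1 hp0)

open RelayNbhd MergeStability in
/-- **Cumulative isolation at level 2 for observers with relay-only neighbourhoods** (the shape of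
`stub_cumulativeIsolation` at `j = 2`, restricted to observers all of whose positive-weight pairs go to
relays): `∃ a ∈ A, P(1 ≤ N ≤ 2) ≤ P(|T_a| ≤ 2)` — with `a` a level-2 champion of `G − o`.  By Markov on
`#{x : x ↮ a}` this gives `P(1 ≤ N ≤ 2) ≤ (|A|−1)·t/(|A|−2)` for such observers (`t` = max pairwise
disconnection probability), i.e. the `|A| = 5` rung of the one-cut engine in this regime.
[cite: KozmaNitzan2024, §3.2 (p. 12) — analogue; VandenbergHaggstromKahn2005, Thm. 1.5 (p. 7)] -/
theorem cumulativeIsolationTwo_of_relayNeighbourhood (n : ℕ) (w : Sym2 (Fin n) → unitInterval)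
    (A : Finset (Fin n)) (o : Fin n) (hA : A.Nonempty) (ho : o ∉ A)
    (hrel : ∀ v : Fin n, v ≠ o → 0 < (w s(o, v) : ℝ) → v ∈ A) :
    ∃ a ∈ A, (prodBernoulli w).real {ω : BondConfig (Fin n) |
        1 ≤ (A.filter fun x => ω ∈ openConn o x).card ∧
          (A.filter fun x => ω ∈ openConn o x).card ≤ 2} ≤
      (prodBernoulli w).real {ω : BondConfig (Fin n) |
        (A.filter fun u => ω ∈ openConn a u).card ≤ 2} := by
  obtain ⟨a, ha, hchamp⟩ := exists_champion (prodBernoulli (pinW w {e : Sym2 (Fin n) | o ∈ e ∧ ¬ e.IsDiag} ∅)) A hA 2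
  refine ⟨a, ha, (clusterSizeTransferTwo_of_relayNeighbourhood n w A o a ho ha hrel hchamp).trans
    (measureReal_mono (fun ω hω => hω.2) (measure_ne_top _ _))⟩

end Summit.CriticalPhenomena.PercolationContinuityZ3.Theorems
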